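import Literature.NumberTheory.EllipticCurves.ModularSymbolsManin
import HarnessLib

/-!
# Crux `ThetaLayerLambdaCongruenceAtTwo` (stmt-BirchSwinnertonDyer-20688, route ResidualThetaTransportAtTwo), line
# `birth` v13 — SD floor at `ℓ = 2`, brick S1 (part 1): the Γ₀(N)-SYMBOL FUNCTION OF A CUSP-CHARACTER (width seat
# bsd-wall-rtt-p3-w2 g8; `--supports stmt-BirchSwinnertonDyer-20688 --as helper`; closes nothing)

HONEST FRAMING. Elementary THEOREMS about an abstract character `u : Γ₀(N) → R` and functions `ℚ → R`; pure `SL₂(ℤ)` algebra.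
Nothing about any curve or form is asserted; BSD is not proved by any of this.

WHAT (`exists_maninFunction_of_cuspCharacter`). Let `u : Γ₀(N) → R` (`R` any additive group) be additive and vanish on the
stabiliser of every cusp: `u(γ) = 0` whenever `(k⁻¹γk)₁₀ = 0` for some `k ∈ SL₂(ℤ)` (i.e. `γ` fixes `k·∞`; this contains `±1` and
every `±`parabolic element). Then there is a Γ₀(N)-symbol function `Φ : ℚ → R` in the currency of the line — Manin's relation
`Φ(γ·r) = Φ(γ·∞) + Φ(r)` written inline exactly as in `…PeriodHom` / `…ManinSymbols` / (C3k) — whose CUSP VALUES ARE `u`: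
`Φ(γ·∞) = u(γ)` (the value at `∞` read as `0`). This is the (boundary-split) section of the period map `Symb_Γ₀(N)(R) → H¹(Γ₀(N), R)`
of `…PeriodHom` over the characters killing the cusp stabilisers: `P¹(ℚ) = SL₂(ℤ)/B`, `B = Stab(∞)` the upper-triangular
matrices; choose a representative `k₀` of every double coset `Γ₀(N) k B` (`k₀ = 1` on `Γ₀(N)B`) and put `Φ(g·∞) := u(γ)` for
`g ∈ γ k₀ B` — two such `γ` differ by an element of `Γ₀(N) ∩ k₀Bk₀⁻¹`, a cusp stabiliser. §1 small `SL₂(ℤ)` facts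
(`(Xβ)₁₀ = X₁₀β₀₀` for upper-triangular `β`); §2 the construction. Used by
`…ThetaLayerLambdaCongruenceAtTwoParabolicCharacterFactor` (brick S1 of `Lines/birth-sd2-architecture.md`: characters killing cusp
stabilisers and order-`4` elliptic elements factor through the period lattice `H₁(X₀(N), ℤ)`).

References: [Manin1972] §1.5–1.7 (symbols on `P¹(ℚ)`, the boundary map); [CremonaAlgorithms1997] §2.1–2.2; [ShimuraIATAF1971] §8.1.
-/

set_option autoImplicit false

noncomputable section

-- justification: the `Summit.BirchSwinnertonDyer.BirchSwinnertonDyer.…` path repeats a component (route-file convention)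
set_option linter.dupNamespace false

open scoped Classical MatrixGroups

open CongruenceSubgroup Matrix.SpecialLinearGroup ModularGroup

namespace Summit.BirchSwinnertonDyer.BirchSwinnertonDyer.Theorems.ThetaLayerLambdaCongruenceAtTwo

/-! ## §1–2. Small `SL₂(ℤ)` facts; the symbol function of a character killing the cusp stabilisers -/

section CuspCharacter

variable {R : Type} [AddCommGroup R] {N : ℕ}

/-- Lower-left entry of a product with an upper-triangular right factor: `(Xβ)₁₀ = X₁₀ β₀₀`. [folklore] -/
theorem sl_mul_apply_10_of_upper (X β : SL(2, ℤ)) (hβ : β 1 0 = 0) : (X * β) 1 0 = X 1 0 * β 0 0 := by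
  have e := (Matrix.two_mul_expl (X : Matrix (Fin 2) (Fin 2) ℤ) (β : Matrix (Fin 2) (Fin 2) ℤ)).2.2.1
  rw [Matrix.SpecialLinearGroup.coe_mul]
  rw [e, hβ, mul_zero, add_zero]

/-- An upper-triangular element of `SL₂(ℤ)` has unit diagonal: `β₀₀ ≠ 0`. [folklore] -/
theorem sl_apply_00_ne_zero_of_upper (β : SL(2, ℤ)) (hβ : β 1 0 = 0) : β 0 0 ≠ 0 := by
  have h := Matrix.det_fin_two β.1
  rw [β.2] at h
  intro h0
  have : (1 : ℤ) = 0 := by rw [h]; simp [h0, hβ]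
  exact one_ne_zero this

/-- `(Xβ)₁₀ = 0 ↔ X₁₀ = 0` for upper-triangular `β ∈ SL₂(ℤ)`. [folklore] -/
theorem sl_mul_apply_10_eq_zero_iff_of_upper (X β : SL(2, ℤ)) (hβ : β 1 0 = 0) : (X * β) 1 0 = 0 ↔ X 1 0 = 0 := by
  rw [sl_mul_apply_10_of_upper X β hβ, mul_eq_zero, or_iff_left (sl_apply_00_ne_zero_of_upper β hβ)]

/-- The upper-triangular elements are closed under products. [folklore] -/
theorem sl_mul_apply_10_eq_zero (X Y : SL(2, ℤ)) (hX : X 1 0 = 0) (hY : Y 1 0 = 0) : (X * Y) 1 0 = 0 := by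
  rw [sl_mul_apply_10_of_upper X Y hY, hX, zero_mul]

/-- **The symbol function of a cusp-character.** Let `u : Γ₀(N) → R` be additive and vanish on the stabiliser of every cusp
(`u(γ) = 0` whenever `(k⁻¹γk)₁₀ = 0` for some `k ∈ SL₂(ℤ)`, i.e. `γ` fixes `k·∞`; this includes `±1` and all `±`parabolic
elements). Then there is a Γ₀(N)-symbol function `Φ : ℚ → R` — Manin's relation `Φ(γ·r) = Φ(γ·∞) + Φ(r)` — whose cusp values are
`u`: `Φ(γ·∞) = u(γ)` (read as `0 = u(γ)` when `γ·∞ = ∞`). Construction: `P¹(ℚ) = SL₂(ℤ)/B`, `B = Stab(∞)`; choose a representative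
`k₀` of each double coset `Γ₀(N) k B` (with `k₀ = 1` on `Γ₀(N)B`) and put `Φ(g·∞) := u(γ)` for `g ∈ γ k₀ B` — well defined because
two such `γ` differ by an element of `Γ₀(N) ∩ k₀Bk₀⁻¹`, killed by `u`. (This is the section `H¹ → Symb` over the boundary: the
Eisenstein ambiguity is fixed by the choice of representatives.) [cite: Manin1972, §1.5–1.7] -/
theorem exists_maninFunction_of_cuspCharacter (u : Gamma0 N → R) (hadd : ∀ γ δ : Gamma0 N, u (γ * δ) = u γ + u δ)
    (hstab : ∀ (γ : Gamma0 N) (k : SL(2, ℤ)), (k⁻¹ * (γ : SL(2, ℤ)) * k) 1 0 = 0 → u γ = 0) :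
    ∃ Φ : ℚ → R,
      (∀ (γ : Gamma0 N) (r : ℚ), ((γ : SL(2, ℤ)) 1 0 : ℚ) * r + ((γ : SL(2, ℤ)) 1 1 : ℚ) ≠ 0 →
        Φ ((((γ : SL(2, ℤ)) 0 0 : ℚ) * r + ((γ : SL(2, ℤ)) 0 1 : ℚ)) /
          (((γ : SL(2, ℤ)) 1 0 : ℚ) * r + ((γ : SL(2, ℤ)) 1 1 : ℚ))) =
          (if ((γ : SL(2, ℤ)) 1 0) = 0 then 0 else Φ ((((γ : SL(2, ℤ)) 0 0 : ℚ)) / (((γ : SL(2, ℤ)) 1 0 : ℚ)))) + Φ r) ∧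
      (∀ γ : Gamma0 N,
        (if ((γ : SL(2, ℤ)) 1 0) = 0 then (0 : R) else Φ ((((γ : SL(2, ℤ)) 0 0 : ℚ)) / (((γ : SL(2, ℤ)) 1 0 : ℚ)))) = u γ) := by
  classical
  -- `u` is a homomorphism: `u 1 = 0`, `u γ⁻¹ = -u γ`
  have hu1 : u 1 = 0 := by
    have h := hadd 1 1
    rw [one_mul] at h
    exact left_eq_add.mp h
  have huinv : ∀ γ : Gamma0 N, u γ⁻¹ = -u γ := fun γ ↦ by
    have h := hadd γ γ⁻¹
    rw [mul_inv_cancel, hu1] at h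
    exact (neg_eq_of_add_eq_zero_right h.symm).symm
  -- the double-coset relation `g ∈ Γ₀(N) k B` (`B = Stab(∞)` = upper-triangular), as an opaque predicate
  obtain ⟨P, hP⟩ : ∃ P : SL(2, ℤ) → SL(2, ℤ) → Prop,
      ∀ k g, P k g ↔ ∃ γ : Gamma0 N, ((((γ : SL(2, ℤ)) * k)⁻¹ * g) 1 0 = 0) := ⟨_, fun _ _ ↦ Iff.rfl⟩
  have P_refl : ∀ g, P g g := fun g ↦ (hP g g).mpr ⟨1, by
    rw [OneMemClass.coe_one, one_mul, inv_mul_cancel]; rfl⟩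
  -- invariance of the relation in the second variable under `g ↦ δ g β`
  have P_iff : ∀ (k g : SL(2, ℤ)) (δ : Gamma0 N) (β : SL(2, ℤ)), β 1 0 = 0 →
      (P k ((δ : SL(2, ℤ)) * g * β) ↔ P k g) := by
    intro k g δ β hβ
    rw [hP, hP]
    constructor
    · rintro ⟨γ, hγ⟩
      refine ⟨δ⁻¹ * γ, ?_⟩
      rw [← mul_assoc, sl_mul_apply_10_eq_zero_iff_of_upper _ β hβ] at hγ
      rw [Subgroup.coe_mul, InvMemClass.coe_inv]
      convert hγ using 2
      group
    · rintro ⟨γ, hγ⟩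
      refine ⟨δ * γ, ?_⟩
      rw [← mul_assoc, sl_mul_apply_10_eq_zero_iff_of_upper _ β hβ, Subgroup.coe_mul]
      convert hγ using 2
      group
  -- representatives (`1` on the double coset of `1`)
  let k₀ : SL(2, ℤ) → SL(2, ℤ) := fun g ↦ if P 1 g then 1 else Classical.epsilon (fun k ↦ P k g)
  have hk₀P : ∀ g, P (k₀ g) g := by
    intro g
    by_cases h : P 1 g
    · simp only [k₀, if_pos h]; exact h
    · simp only [k₀, if_neg h]; exact Classical.epsilon_spec (p := fun k ↦ P k g) ⟨g, P_refl g⟩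
  have hk1 : k₀ 1 = 1 := by simp only [k₀, if_pos (P_refl 1)]
  have k₀_eq : ∀ (g : SL(2, ℤ)) (δ : Gamma0 N) (β : SL(2, ℤ)), β 1 0 = 0 → k₀ ((δ : SL(2, ℤ)) * g * β) = k₀ g := by
    intro g δ β hβ
    have e : (fun k ↦ P k ((δ : SL(2, ℤ)) * g * β)) = (fun k ↦ P k g) :=
      funext fun k ↦ propext (P_iff k g δ β hβ)
    simp only [k₀, P_iff 1 g δ β hβ, e]
  have hk₀ : ∀ g, ∃ γ : Gamma0 N, ((((γ : SL(2, ℤ)) * k₀ g)⁻¹ * g) 1 0 = 0) := fun g ↦ (hP _ _).mp (hk₀P g)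
  clear_value k₀
  -- the function on `SL₂(ℤ)`
  let F : SL(2, ℤ) → R := fun g ↦ u (Classical.choose (hk₀ g))
  have hF_spec : ∀ g, ((((Classical.choose (hk₀ g) : Gamma0 N) : SL(2, ℤ)) * k₀ g)⁻¹ * g) 1 0 = 0 :=
    fun g ↦ Classical.choose_spec (hk₀ g)
  have hF_def : ∀ g, F g = u (Classical.choose (hk₀ g)) := fun g ↦ rfl
  clear_value F
  -- two witnesses for `g` and `δ g β` over the same representative differ by a stabiliser element
  have hwit : ∀ (k g : SL(2, ℤ)) (γ γ' δ : Gamma0 N) (β : SL(2, ℤ)), β 1 0 = 0 →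
      (((γ : SL(2, ℤ)) * k)⁻¹ * g) 1 0 = 0 → (((γ' : SL(2, ℤ)) * k)⁻¹ * ((δ : SL(2, ℤ)) * g * β)) 1 0 = 0 →
      u γ' = u δ + u γ := by
    intro k g γ γ' δ β hβ h1 h2
    have h2' : (((γ' : SL(2, ℤ)) * k)⁻¹ * ((δ : SL(2, ℤ)) * g)) 1 0 = 0 := by
      rw [← mul_assoc, sl_mul_apply_10_eq_zero_iff_of_upper _ β hβ] at h2; exact h2
    -- `X := (γ'k)⁻¹ δ g`, `Y := (γ k)⁻¹ g`; `X * Y⁻¹ = k⁻¹ (γ'⁻¹ δ γ) k` is upper triangular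
    have hXY : ((((γ' : SL(2, ℤ)) * k)⁻¹ * ((δ : SL(2, ℤ)) * g)) * ((((γ : SL(2, ℤ)) * k)⁻¹ * g))⁻¹) 1 0 = 0 :=
      sl_mul_apply_10_eq_zero _ _ h2' (by
        rw [show ∀ X : SL(2, ℤ), (X⁻¹) 1 0 = -X 1 0 from fun X ↦ by rw [Matrix.SpecialLinearGroup.SL2_inv_expl]; rfl,
          h1, neg_zero])
    have e : (((γ' : SL(2, ℤ)) * k)⁻¹ * ((δ : SL(2, ℤ)) * g)) * ((((γ : SL(2, ℤ)) * k)⁻¹ * g))⁻¹ =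
        k⁻¹ * ((γ'⁻¹ * δ * γ : Gamma0 N) : SL(2, ℤ)) * k := by
      rw [Subgroup.coe_mul, Subgroup.coe_mul, InvMemClass.coe_inv]
      group
    rw [e] at hXY
    have h0 := hstab (γ'⁻¹ * δ * γ) k hXY
    rw [hadd, hadd, huinv, add_assoc] at h0
    exact neg_add_eq_zero.mp h0
  -- (F2) `F(δ g β) = u δ + F g`
  have hF : ∀ (g : SL(2, ℤ)) (δ : Gamma0 N) (β : SL(2, ℤ)), β 1 0 = 0 → F ((δ : SL(2, ℤ)) * g * β) = u δ + F g := by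
    intro g δ β hβ
    obtain ⟨γ, hγF, h1⟩ : ∃ γ : Gamma0 N, F g = u γ ∧ ((((γ : SL(2, ℤ)) * k₀ g)⁻¹ * g) 1 0 = 0) :=
      ⟨_, hF_def g, hF_spec g⟩
    obtain ⟨γ', hγ'F, h2⟩ : ∃ γ' : Gamma0 N, F ((δ : SL(2, ℤ)) * g * β) = u γ' ∧
        ((((γ' : SL(2, ℤ)) * k₀ ((δ : SL(2, ℤ)) * g * β))⁻¹ * ((δ : SL(2, ℤ)) * g * β)) 1 0 = 0) :=
      ⟨_, hF_def _, hF_spec _⟩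
    rw [k₀_eq g δ β hβ] at h2
    rw [hγF, hγ'F]
    exact hwit (k₀ g) g γ γ' δ β hβ h1 h2
  -- (F3) `F 1 = 0`, `F γ = u γ`, `F (gβ) = F g`, `F (δ g) = u δ + F g`
  have hF1 : F 1 = 0 := by
    obtain ⟨γ₁, hγF, h1⟩ : ∃ γ₁ : Gamma0 N, F 1 = u γ₁ ∧ ((((γ₁ : SL(2, ℤ)) * k₀ 1)⁻¹ * 1) 1 0 = 0) :=
      ⟨_, hF_def 1, hF_spec 1⟩
    rw [hk1, mul_one, mul_one,
      show ∀ X : SL(2, ℤ), (X⁻¹) 1 0 = -X 1 0 from fun X ↦ by rw [Matrix.SpecialLinearGroup.SL2_inv_expl]; rfl,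
      neg_eq_zero] at h1
    rw [hγF]
    refine hstab _ 1 ?_
    rw [inv_one, one_mul, mul_one]
    exact h1
  have hFγ : ∀ γ : Gamma0 N, F (γ : SL(2, ℤ)) = u γ := fun γ ↦ by
    have := hF 1 γ 1 rfl
    rw [mul_one, mul_one, hF1, add_zero] at this
    exact this
  have hFβ : ∀ (g β : SL(2, ℤ)), β 1 0 = 0 → F (g * β) = F g := fun g β hβ ↦ by
    have := hF g 1 β hβ
    rw [OneMemClass.coe_one, one_mul, hu1, zero_add] at this
    exact this
  have hFδ : ∀ (g : SL(2, ℤ)) (δ : Gamma0 N), F ((δ : SL(2, ℤ)) * g) = u δ + F g := fun g δ ↦ by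
    have := hF g δ 1 rfl
    rw [mul_one] at this
    exact this
  -- the Bezout matrix of a rational
  have hmat : ∀ r : ℚ, ∃ k : SL(2, ℤ), k 1 0 ≠ 0 ∧ ((k 0 0 : ℚ)) / ((k 1 0 : ℚ)) = r := by
    intro r
    have hcop : Int.gcd r.num (r.den : ℤ) = 1 := by
      change r.num.natAbs.gcd (r.den : ℤ).natAbs = 1
      rw [Int.natAbs_natCast]
      exact r.reduced
    have hbez := Int.gcd_eq_gcd_ab r.num (r.den : ℤ)
    rw [hcop, Nat.cast_one] at hbez
    refine ⟨⟨!![r.num, -Int.gcdB r.num (r.den : ℤ); (r.den : ℤ), Int.gcdA r.num (r.den : ℤ)], by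
      rw [Matrix.det_fin_two_of]; linear_combination -hbez⟩, ?_, ?_⟩
    · show ((r.den : ℤ)) ≠ 0
      exact_mod_cast r.den_nz
    · show ((r.num : ℤ) : ℚ) / (((r.den : ℕ) : ℤ) : ℚ) = r
      push_cast
      exact Rat.num_div_den r
  choose kr hkr0 hkr using hmat
  -- two matrices with the same cusp differ by an upper-triangular right factor
  have hupper : ∀ (k g : SL(2, ℤ)), k 1 0 ≠ 0 → g 1 0 ≠ 0 →
      ((k 0 0 : ℚ)) / ((k 1 0 : ℚ)) = ((g 0 0 : ℚ)) / ((g 1 0 : ℚ)) → (k⁻¹ * g) 1 0 = 0 := by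
    intro k g hk hg h
    have hcross : k 0 0 * g 1 0 = g 0 0 * k 1 0 := by
      rw [div_eq_div_iff (by exact_mod_cast hk) (by exact_mod_cast hg)] at h
      exact_mod_cast h
    have e := (Matrix.two_mul_expl ((k⁻¹ : SL(2, ℤ)) : Matrix (Fin 2) (Fin 2) ℤ) (g : Matrix (Fin 2) (Fin 2) ℤ)).2.2.1
    rw [Matrix.SpecialLinearGroup.coe_mul, e]
    have i10 : ((k⁻¹ : SL(2, ℤ)) : Matrix (Fin 2) (Fin 2) ℤ) 1 0 = -k 1 0 := by
      rw [Matrix.SpecialLinearGroup.SL2_inv_expl]; rfl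
    have i11 : ((k⁻¹ : SL(2, ℤ)) : Matrix (Fin 2) (Fin 2) ℤ) 1 1 = k 0 0 := by
      rw [Matrix.SpecialLinearGroup.SL2_inv_expl]; rfl
    rw [i10, i11]
    linear_combination hcross
  -- (Φ1) the value of `r ↦ F (kr r)` at `g·∞` is `F g`
  have hΦ1 : ∀ g : SL(2, ℤ), g 1 0 ≠ 0 → F (kr (((g 0 0 : ℚ)) / ((g 1 0 : ℚ)))) = F g := by
    intro g hg
    have hβ := hupper (kr (((g 0 0 : ℚ)) / ((g 1 0 : ℚ)))) g (hkr0 _) hg (hkr _)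
    have e : g = kr (((g 0 0 : ℚ)) / ((g 1 0 : ℚ))) * ((kr (((g 0 0 : ℚ)) / ((g 1 0 : ℚ))))⁻¹ * g) := by
      rw [mul_inv_cancel_left]
    conv_rhs => rw [e]
    rw [hFβ _ _ hβ]
  -- cusp values `Φ(γ·∞) = u γ`
  have hcusp : ∀ γ : Gamma0 N,
      (if ((γ : SL(2, ℤ)) 1 0) = 0 then (0 : R)
        else F (kr ((((γ : SL(2, ℤ)) 0 0 : ℚ)) / (((γ : SL(2, ℤ)) 1 0 : ℚ))))) = u γ := by
    intro γ
    by_cases hc : (γ : SL(2, ℤ)) 1 0 = 0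
    · rw [if_pos hc]
      refine (hstab γ 1 ?_).symm
      rw [inv_one, one_mul, mul_one]; exact hc
    · rw [if_neg hc, hΦ1 _ hc, hFγ]
  refine ⟨fun r ↦ F (kr r), ?_, hcusp⟩
  intro γ r hden
  -- `γ·r = (γ k)·∞` with `k = kr r`
  set k := kr r with hk
  have hk0 : (k 1 0 : ℚ) ≠ 0 := by exact_mod_cast hkr0 r
  have hrk : r = ((k 0 0 : ℚ)) / ((k 1 0 : ℚ)) := (hkr r).symm
  have e00 : (((γ : SL(2, ℤ)) * k) 0 0) = (γ : SL(2, ℤ)) 0 0 * k 0 0 + (γ : SL(2, ℤ)) 0 1 * k 1 0 :=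
    (Matrix.two_mul_expl ((γ : SL(2, ℤ)) : Matrix (Fin 2) (Fin 2) ℤ) (k : Matrix (Fin 2) (Fin 2) ℤ)).1
  have e10 : (((γ : SL(2, ℤ)) * k) 1 0) = (γ : SL(2, ℤ)) 1 0 * k 0 0 + (γ : SL(2, ℤ)) 1 1 * k 1 0 :=
    (Matrix.two_mul_expl ((γ : SL(2, ℤ)) : Matrix (Fin 2) (Fin 2) ℤ) (k : Matrix (Fin 2) (Fin 2) ℤ)).2.2.1
  have h10Q : ((((γ : SL(2, ℤ)) * k) 1 0 : ℤ) : ℚ) ≠ 0 := by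
    rw [e10]; push_cast
    intro h
    apply hden
    have : (((γ : SL(2, ℤ)) 1 0 : ℚ) * r + ((γ : SL(2, ℤ)) 1 1 : ℚ)) * (k 1 0 : ℚ) = 0 := by
      rw [hrk]; field_simp; linear_combination h
    exact (mul_eq_zero.mp this).resolve_right hk0
  have h10 : ((γ : SL(2, ℤ)) * k) 1 0 ≠ 0 := by exact_mod_cast h10Q
  have hval : ((((γ : SL(2, ℤ)) 0 0 : ℚ) * r + ((γ : SL(2, ℤ)) 0 1 : ℚ)) /
      (((γ : SL(2, ℤ)) 1 0 : ℚ) * r + ((γ : SL(2, ℤ)) 1 1 : ℚ))) =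
      (((((γ : SL(2, ℤ)) * k) 0 0 : ℤ) : ℚ)) / (((((γ : SL(2, ℤ)) * k) 1 0 : ℤ) : ℚ)) := by
    rw [div_eq_div_iff hden h10Q, e00, e10, hrk]
    push_cast
    field_simp
  show F (kr _) = _ + F (kr r)
  rw [hval, hΦ1 _ h10, hFδ, ← hk, hcusp]

end CuspCharacter

end Summit.BirchSwinnertonDyer.BirchSwinnertonDyer.Theorems.ThetaLayerLambdaCongruenceAtTwo

end
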